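/-
Literature anchor (engines group, cap lane, anchor #21): quadratic convolutions of sequences with
geometrically decaying tails — the estimates of the Kuramoto–Sivashinsky nonlinearity on the
self-consistent bounds `W_{q,S}` and `GBound(m, ã, S, q)` of Wilczak–Zgliczyński (2020), with
explicit constants, and the monotonicity facts behind the uniform far-tail bound.
-/
import Mathlib
import HarnessLib

/-!
# Quadratic convolutions of geometrically decaying sequences (KS nonlinearity on `W_{q,S}`)

Topic `Literature/Analysis/ODE` (companion of `PolynomialDecayConvolution.lean`, which treats
polynomial tails `|a_n| ≤ C n^{-s}`, and of `GalerkinCompactness.lean`, which proves the sets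
below compact).  The Kuramoto–Sivashinsky equation with odd periodic boundary conditions,
`u_t = -ν u_xxxx - u_xx + (u²)_x`, `u = Σ_{k≥1} -2 a_k sin(kx)`, reads in Fourier coordinates
`a_k' = k²(1 - νk²) a_k + N_k(a)` with the quadratic nonlinearity
`N_k(a) = -k Σ_{n=1}^{k-1} a_n a_{k-n} + 2k Σ_{n≥1} a_n a_{n+k}`
([WilczakZgliczynski2020, §5.1]).  Wilczak–Zgliczyński integrate it on sets with a GEOMETRIC tail:
`W_{q,S} = {|a_n| ≤ S q^{-n}, n ≥ 1}` and, with explicitly bounded low modes,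
`GBound(m, ã, S, q) = {|a_n| ≤ ã_n (n ≤ m), |a_n| ≤ S q^{-n} (n > m)}` (`q > 1`).  This file proves
the convolution estimates on these sets with their explicit constants (real sequences
`a : ℕ → ℝ`, modes indexed from `1`; every infinite sum is stated for all its finite partial sums,
so no summability hypothesis is needed, and the `tsum` forms follow):

* `sum_inv_pow_two_mul_le` — the geometric tail `Σ_{n∈J} q^{-2n} ≤ q^{-2m}/(q²-1)` for finite
  `J ⊆ (m, ∞)`.
* `sum_abs_mul_add_le_of_tail` — [WilczakZgliczynski2020, §5.2 Lemma 19] (order `i = 0`): the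
  infinite part `I_k = Σ_{n>m} a_n a_{n+k}` has `Σ_{n∈J} |a_n| |a_{n+k}| ≤ S² q^{-k} q^{-2m}/(q²-1)`
  for every `k` and every finite `J ⊆ (m, ∞)`; `tsum_abs_mul_add_le_of_tail` — the series form.
* `sum_Icc_abs_mul_sub_le`, `sum_Ioo_abs_mul_sub_le`, `sum_Ioo_abs_mul_sub_le_of_gbound`,
  `sum_Icc_abs_mul_add_le`, `sum_abs_mul_add_le_of_gbound` — [WilczakZgliczynski2020, §5.2
  Lemma 21] (order `i = 0`, the intermediate bounds of its proof): for `k > 2m`,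
  `Σ_{n=1}^{k-1} |a_n| |a_{k-n}| ≤ q^{-k} (2S Σ_{n=1}^{m} q^n ã_n + S² (k-2m-1))` (the low × tail
  blocks `Σ₁` and the tail × tail block `Σ₂` with its exact count `k - 2m - 1`), and for `k > m`,
  `Σ_{n∈J} |a_n| |a_{n+k}| ≤ q^{-k} S (Σ_{n=1}^{m} q^{-n} ã_n + S q^{-2m}/(q²-1))`
  (`J ⊆ [1, ∞)` finite).
* `ks_quadratic_le_of_gbound`, `ks_nonlinearity_abs_le_of_gbound` — the resulting bound of the
  KS nonlinearity at a far mode `k > 2m` on `GBound`: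
  `k Σ_{n=1}^{k-1} |a_n||a_{k-n}| + 2k Σ_{n∈J} |a_n||a_{n+k}| ≤ q^{-k} k (c₁ + S² (k-2m-1))`,
  `c₁ = 2S (Σ_{n≤m} q^n ã_n + Σ_{n≤m} q^{-n} ã_n + S q^{-2m}/(q²-1))`.
* `ks_quadratic_le_of_geom`, `ks_nonlinearity_abs_le_of_geom` — [WilczakZgliczynski2020, §5.1,
  condition C2 for KS]: on `W_{q,S}`,
  `|N_k(a)| ≤ k(k-1) S² q^{-k} + 2k S² q^{-k}/(q²-1) ≤ 2k² q^{-k} S² (1 + 1/(q²-1))`.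
* `ks_eigen_pos`, `ks_eigen_lt`, `far_ratio_le`, `far_weighted_le` — the monotonicity behind the
  UNIFORM far-tail bound ([WilczakZgliczynski2020, §4.3, proof of Lemma 18]: for the linear part
  `L_k = k²(νk² - 1)` and a nonlinearity bound `D k^r q^{-k}`, the ratio `q^k D k^r q^{-k}/L_k` is
  non-increasing in `k`, so its value at the first far mode bounds all of them): for `νK² > 1` and
  `K ≤ k < k'`, `0 < νk⁴ - k² < νk'⁴ - k'²`, `(c₁/k + c₂)/(νk² - 1) ≤ (c₁/K + c₂)/(νK² - 1)`, and
  `x ≤ q^{-k} k (c₁ + c₂ k)` implies `q^k x/(νk⁴ - k²) ≤ (c₁/K + c₂)/(νK² - 1)`.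

What this buys (cap lane): these are the bound formulas (B1) (remainder term
`2k S² q^{-k} q^{-2M}/(q²-1)`), (B3) (far tail `|F_k - λ_k a_k| ≤ q^{-k} k (c₁ + S² (k-2M-1)⁺)`,
`c₁ = 2S(SA + B2)`) and (B4) (`FAR = (c₁/(2M+1) + c₂)/(ν(2M+1)² - 1)`, `|λ_k|` increasing) of the
`ks-odd-periodic` problem kind of `cap.pde`, re-derived per step by both verifiers; here they are
theorems about the exact sums (the paper's `m` is the engine's `M`, the last explicitly bounded
mode).  No facts, no axioms, no `sorry`.

## References

* D. Wilczak, P. Zgliczyński, *A geometric method for infinite-dimensional chaos: symbolic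
  dynamics for the Kuramoto–Sivashinsky PDE on the line*, J. Differential Equations 269 (2020)
  8509–8548, §4.3 (Lemma 18), §5.1 (C1–C2 for KS), §5.2 (Lemmas 19, 21). [WilczakZgliczynski2020;
  held: paper:arxiv-1710.00329, pp. 13–15]
* P. Zgliczyński, K. Mischaikow, *Rigorous numerics for partial differential equations: the
  Kuramoto–Sivashinsky equation*, Found. Comput. Math. 1 (2001) 255–288. [ZgliczynskiMischaikow2001]
* D. Wilczak, P. Zgliczyński, *Self-consistent bounds method for dissipative PDEs*,
  arXiv:2502.09760 (2025), §7.5 Thm. 26 (the sets `W_exp(q,S)`). [WilczakZgliczynski2025]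
-/

noncomputable section

open Finset

namespace Literature.Analysis.ODE

/-! ### Geometric tails -/

/-- The geometric tail: for `q > 1` and a finite set `J` of indices `n > m`,
`∑_{n∈J} q^{-2n} ≤ q^{-2m}/(q²-1)` (`= ∑_{n>m} q^{-2n}`).
[cite: WilczakZgliczynski2020, §5.2 Lemma 19 (proof)] -/
theorem sum_inv_pow_two_mul_le {q : ℝ} (hq : 1 < q) (m : ℕ) (J : Finset ℕ)
    (hJ : ∀ n ∈ J, m < n) : ∑ n ∈ J, (q ^ (2 * n))⁻¹ ≤ (q ^ (2 * m))⁻¹ / (q ^ 2 - 1) := by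
  have hq0 : 0 < q := by linarith
  have hq2 : 1 < q ^ 2 := by nlinarith
  have hx0 : 0 ≤ (q ^ 2)⁻¹ := by positivity
  have hx1 : (q ^ 2)⁻¹ < 1 := inv_lt_one_of_one_lt₀ hq2
  have hterm : ∀ n : ℕ, (q ^ (2 * n))⁻¹ = ((q ^ 2)⁻¹) ^ n := fun n => by
    rw [inv_pow, ← pow_mul]
  have hsub : J ⊆ Finset.Ico (m + 1) (J.sup id + 1) := by
    intro n hn
    rw [Finset.mem_Ico]
    exact ⟨hJ n hn, Nat.lt_succ_of_le (Finset.le_sup (f := id) hn)⟩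
  have hq0' : q ≠ 0 := hq0.ne'
  have h1 : q ^ 2 - 1 ≠ 0 := by linarith
  calc ∑ n ∈ J, (q ^ (2 * n))⁻¹ = ∑ n ∈ J, ((q ^ 2)⁻¹) ^ n :=
        Finset.sum_congr rfl (fun n _ => hterm n)
    _ ≤ ∑ n ∈ Finset.Ico (m + 1) (J.sup id + 1), ((q ^ 2)⁻¹) ^ n :=
        Finset.sum_le_sum_of_subset_of_nonneg hsub (fun n _ _ => by positivity)
    _ ≤ ((q ^ 2)⁻¹) ^ (m + 1) / (1 - (q ^ 2)⁻¹) := geom_sum_Ico_le_of_lt_one hx0 hx1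
    _ = (q ^ (2 * m))⁻¹ / (q ^ 2 - 1) := by
        rw [inv_pow, ← pow_mul]
        field_simp
        ring

/-! ### The infinite part `I_k` (Lemma 19) -/

/-- **[WZ 2020, Lemma 19]** (order `0`): if `|a_n| ≤ S q^{-n}` for `n > m` (`q > 1`), then for
every `k` and every finite set `J` of indices `n > m`,
`∑_{n∈J} |a_n| |a_{n+k}| ≤ S² q^{-k} · q^{-2m}/(q²-1)`.
[cite: WilczakZgliczynski2020, §5.2 Lemma 19] -/
theorem sum_abs_mul_add_le_of_tail {q S : ℝ} (hq : 1 < q) (hS0 : 0 ≤ S) {m : ℕ} {a : ℕ → ℝ}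
    (hS : ∀ n : ℕ, m < n → |a n| ≤ S / q ^ n) (k : ℕ) (J : Finset ℕ) (hJ : ∀ n ∈ J, m < n) :
    ∑ n ∈ J, |a n| * |a (n + k)| ≤ S ^ 2 * (q ^ k)⁻¹ * ((q ^ (2 * m))⁻¹ / (q ^ 2 - 1)) := by
  have hq0 : 0 < q := by linarith
  have hterm : ∀ n ∈ J, |a n| * |a (n + k)| ≤ S ^ 2 * (q ^ k)⁻¹ * (q ^ (2 * n))⁻¹ := by
    intro n hn
    have h1 := hS n (hJ n hn)
    have h2 := hS (n + k) (by have := hJ n hn; omega)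
    calc |a n| * |a (n + k)| ≤ (S / q ^ n) * (S / q ^ (n + k)) :=
          mul_le_mul h1 h2 (abs_nonneg _) (by positivity)
      _ = S ^ 2 * (q ^ k)⁻¹ * (q ^ (2 * n))⁻¹ := by
          rw [two_mul, pow_add, pow_add]
          field_simp
  calc ∑ n ∈ J, |a n| * |a (n + k)| ≤ ∑ n ∈ J, S ^ 2 * (q ^ k)⁻¹ * (q ^ (2 * n))⁻¹ :=
        Finset.sum_le_sum hterm
    _ = S ^ 2 * (q ^ k)⁻¹ * ∑ n ∈ J, (q ^ (2 * n))⁻¹ := by rw [Finset.mul_sum]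
    _ ≤ S ^ 2 * (q ^ k)⁻¹ * ((q ^ (2 * m))⁻¹ / (q ^ 2 - 1)) := by
        gcongr
        exact sum_inv_pow_two_mul_le hq m J hJ

/-- **[WZ 2020, Lemma 19]** as a bound of the infinite sum `I_k = Σ_{n>m} a_n a_{n+k}` (indices
shifted to start at `m + 1`): the series `Σ_{i≥0} |a_{i+m+1}| |a_{i+m+1+k}|` converges and is at
most `S² q^{-k} · q^{-2m}/(q²-1)`. [cite: WilczakZgliczynski2020, §5.2 Lemma 19] -/
theorem tsum_abs_mul_add_le_of_tail {q S : ℝ} (hq : 1 < q) (hS0 : 0 ≤ S) {m : ℕ} {a : ℕ → ℝ}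
    (hS : ∀ n : ℕ, m < n → |a n| ≤ S / q ^ n) (k : ℕ) :
    Summable (fun i : ℕ => |a (i + (m + 1))| * |a (i + (m + 1) + k)|) ∧
      ∑' i : ℕ, |a (i + (m + 1))| * |a (i + (m + 1) + k)| ≤
        S ^ 2 * (q ^ k)⁻¹ * ((q ^ (2 * m))⁻¹ / (q ^ 2 - 1)) := by
  classical
  have hbound : ∀ F : Finset ℕ, ∑ i ∈ F, |a (i + (m + 1))| * |a (i + (m + 1) + k)| ≤
      S ^ 2 * (q ^ k)⁻¹ * ((q ^ (2 * m))⁻¹ / (q ^ 2 - 1)) := by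
    intro F
    have hinj : Set.InjOn (fun i : ℕ => i + (m + 1)) ↑F := fun x _ y _ hxy => by simpa using hxy
    calc ∑ i ∈ F, |a (i + (m + 1))| * |a (i + (m + 1) + k)|
        = ∑ n ∈ F.image (fun i : ℕ => i + (m + 1)), |a n| * |a (n + k)| :=
          (Finset.sum_image (f := fun n : ℕ => |a n| * |a (n + k)|) hinj).symm
      _ ≤ _ := sum_abs_mul_add_le_of_tail hq hS0 hS k _ (fun n hn => by
          obtain ⟨i, _, rfl⟩ := Finset.mem_image.mp hn
          omega)
  have hnn : ∀ i : ℕ, 0 ≤ |a (i + (m + 1))| * |a (i + (m + 1) + k)| := fun i => by positivity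
  exact ⟨summable_of_sum_le hnn hbound, Real.tsum_le_of_sum_le hnn hbound⟩

/-! ### The finite part `E_k` at a far mode (Lemma 21) -/

/-- **[WZ 2020, Lemma 21, block `Σ₁`]** (low × tail, first sum): if `|a_n| ≤ ã_n` for
`1 ≤ n ≤ m` and `|a_n| ≤ S q^{-n}` for `n > m`, then for `k > 2m`
`∑_{n=1}^{m} |a_n| |a_{k-n}| ≤ q^{-k} S ∑_{n=1}^{m} q^n ã_n`.
[cite: WilczakZgliczynski2020, §5.2 Lemma 21 (proof, Σ₁)] -/
theorem sum_Icc_abs_mul_sub_le {q S : ℝ} (hq : 1 < q) {m : ℕ} {a α : ℕ → ℝ}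
    (hα : ∀ n : ℕ, 1 ≤ n → n ≤ m → |a n| ≤ α n) (hS : ∀ n : ℕ, m < n → |a n| ≤ S / q ^ n)
    {k : ℕ} (hk : 2 * m < k) :
    ∑ n ∈ Finset.Icc 1 m, |a n| * |a (k - n)| ≤
      (q ^ k)⁻¹ * S * ∑ n ∈ Finset.Icc 1 m, q ^ n * α n := by
  have hq0 : 0 < q := by linarith
  rw [Finset.mul_sum]
  refine Finset.sum_le_sum (fun n hn => ?_)
  rw [Finset.mem_Icc] at hn
  have h1 := hα n hn.1 hn.2
  have h2 := hS (k - n) (by omega)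
  have hαn : 0 ≤ α n := (abs_nonneg _).trans h1
  have hkn : q ^ (k - n) = q ^ k * (q ^ n)⁻¹ := pow_sub₀ q hq0.ne' (by omega)
  calc |a n| * |a (k - n)| ≤ α n * (S / q ^ (k - n)) := mul_le_mul h1 h2 (abs_nonneg _) hαn
    _ = (q ^ k)⁻¹ * S * (q ^ n * α n) := by
        rw [hkn]
        field_simp

/-- **[WZ 2020, Lemma 21, block `Σ₁`]** (low × tail, second sum): under the same hypotheses,
for `k > m` and `1 ≤ n ≤ m` one has `n + k > m`, so
`∑_{n=1}^{m} |a_n| |a_{n+k}| ≤ q^{-k} S ∑_{n=1}^{m} q^{-n} ã_n`.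
[cite: WilczakZgliczynski2020, §5.2 Lemma 21 (proof, Σ₁)] -/
theorem sum_Icc_abs_mul_add_le {q S : ℝ} (hq : 1 < q) {m : ℕ} {a α : ℕ → ℝ}
    (hα : ∀ n : ℕ, 1 ≤ n → n ≤ m → |a n| ≤ α n) (hS : ∀ n : ℕ, m < n → |a n| ≤ S / q ^ n)
    {k : ℕ} (hk : m < k) :
    ∑ n ∈ Finset.Icc 1 m, |a n| * |a (n + k)| ≤
      (q ^ k)⁻¹ * S * ∑ n ∈ Finset.Icc 1 m, (q ^ n)⁻¹ * α n := by
  have hq0 : 0 < q := by linarith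
  rw [Finset.mul_sum]
  refine Finset.sum_le_sum (fun n hn => ?_)
  rw [Finset.mem_Icc] at hn
  have h1 := hα n hn.1 hn.2
  have h2 := hS (n + k) (by omega)
  have hαn : 0 ≤ α n := (abs_nonneg _).trans h1
  calc |a n| * |a (n + k)| ≤ α n * (S / q ^ (n + k)) := mul_le_mul h1 h2 (abs_nonneg _) hαn
    _ = (q ^ k)⁻¹ * S * ((q ^ n)⁻¹ * α n) := by
        rw [pow_add]
        field_simp

/-- **[WZ 2020, Lemma 21, block `Σ₂`]** (tail × tail): if `|a_n| ≤ S q^{-n}` for `n > m`, then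
`∑_{m<n<k-m} |a_n| |a_{k-n}| ≤ q^{-k} S² (k - 2m - 1)` (`k - m - m - 1` terms, each `≤ S² q^{-k}`;
natural-number subtraction, the sum being empty for `k ≤ 2m + 1`).
[cite: WilczakZgliczynski2020, §5.2 Lemma 21 (proof, Σ₂)] -/
theorem sum_Ioo_abs_mul_sub_le {q S : ℝ} (hq : 1 < q) (hS0 : 0 ≤ S) {m : ℕ} {a : ℕ → ℝ}
    (hS : ∀ n : ℕ, m < n → |a n| ≤ S / q ^ n) (k : ℕ) :
    ∑ n ∈ Finset.Ioo m (k - m), |a n| * |a (k - n)| ≤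
      (q ^ k)⁻¹ * S ^ 2 * ((k - m - m - 1 : ℕ) : ℝ) := by
  have hq0 : 0 < q := by linarith
  have hterm : ∀ n ∈ Finset.Ioo m (k - m), |a n| * |a (k - n)| ≤ (q ^ k)⁻¹ * S ^ 2 := by
    intro n hn
    rw [Finset.mem_Ioo] at hn
    have h1 := hS n hn.1
    have h2 := hS (k - n) (by omega)
    have hkn : q ^ n * q ^ (k - n) = q ^ k := by
      rw [← pow_add, Nat.add_sub_cancel' (by omega : n ≤ k)]
    calc |a n| * |a (k - n)| ≤ (S / q ^ n) * (S / q ^ (k - n)) :=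
          mul_le_mul h1 h2 (abs_nonneg _) (by positivity)
      _ = (q ^ k)⁻¹ * S ^ 2 := by
          rw [div_mul_div_comm, hkn]
          field_simp
  calc ∑ n ∈ Finset.Ioo m (k - m), |a n| * |a (k - n)|
      ≤ ∑ n ∈ Finset.Ioo m (k - m), (q ^ k)⁻¹ * S ^ 2 := Finset.sum_le_sum hterm
    _ = (q ^ k)⁻¹ * S ^ 2 * ((k - m - m - 1 : ℕ) : ℝ) := by
        rw [Finset.sum_const, Nat.card_Ioo, nsmul_eq_mul]
        ring

/-- **[WZ 2020, Lemma 21]** (order `0`, both blocks, with the exact count): if `|a_n| ≤ ã_n` for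
`1 ≤ n ≤ m` and `|a_n| ≤ S q^{-n}` for `n > m` (`q > 1`, `S ≥ 0`), then for every far mode
`k > 2m`, `∑_{n=1}^{k-1} |a_n| |a_{k-n}| ≤ q^{-k} (2S ∑_{n=1}^{m} q^n ã_n + S² (k - 2m - 1))`.
[cite: WilczakZgliczynski2020, §5.2 Lemma 21] -/
theorem sum_Ioo_abs_mul_sub_le_of_gbound {q S : ℝ} (hq : 1 < q) (hS0 : 0 ≤ S) {m : ℕ}
    {a α : ℕ → ℝ} (hα : ∀ n : ℕ, 1 ≤ n → n ≤ m → |a n| ≤ α n)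
    (hS : ∀ n : ℕ, m < n → |a n| ≤ S / q ^ n) {k : ℕ} (hk : 2 * m < k) :
    ∑ n ∈ Finset.Ioo 0 k, |a n| * |a (k - n)| ≤
      (q ^ k)⁻¹ * (2 * S * ∑ n ∈ Finset.Icc 1 m, q ^ n * α n +
        S ^ 2 * ((k - 2 * m - 1 : ℕ) : ℝ)) := by
  classical
  have hsplit : Finset.Ioo 0 k =
      Finset.Icc 1 m ∪ Finset.Ioo m (k - m) ∪ Finset.Icc (k - m) (k - 1) := by
    ext n
    simp only [Finset.mem_union, Finset.mem_Ioo, Finset.mem_Icc]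
    omega
  have hd1 : Disjoint (Finset.Icc 1 m) (Finset.Ioo m (k - m)) := by
    rw [Finset.disjoint_left]
    intro n h1 h2
    rw [Finset.mem_Icc] at h1
    rw [Finset.mem_Ioo] at h2
    omega
  have hd2 : Disjoint (Finset.Icc 1 m ∪ Finset.Ioo m (k - m)) (Finset.Icc (k - m) (k - 1)) := by
    rw [Finset.disjoint_left]
    intro n h1 h2
    simp only [Finset.mem_union, Finset.mem_Icc, Finset.mem_Ioo] at h1 h2
    omega
  rw [hsplit, Finset.sum_union hd2, Finset.sum_union hd1]
  have hA := sum_Icc_abs_mul_sub_le hq hα hS hk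
  have hB := sum_Ioo_abs_mul_sub_le hq hS0 hS k (m := m)
  -- the third block is the first one read backwards (`n ↦ k - n`)
  have hC : ∑ n ∈ Finset.Icc (k - m) (k - 1), |a n| * |a (k - n)| ≤
      (q ^ k)⁻¹ * S * ∑ n ∈ Finset.Icc 1 m, q ^ n * α n := by
    have hinj : Set.InjOn (fun n : ℕ => k - n) ↑(Finset.Icc (k - m) (k - 1)) := by
      intro x hx y hy hxy
      simp only [Finset.coe_Icc, Set.mem_Icc] at hx hy
      simp only at hxy
      omega
    have himg : (Finset.Icc (k - m) (k - 1)).image (fun n : ℕ => k - n) = Finset.Icc 1 m := by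
      ext j
      simp only [Finset.mem_image, Finset.mem_Icc]
      constructor
      · rintro ⟨n, hn, rfl⟩
        omega
      · intro hj
        exact ⟨k - j, by omega, by omega⟩
    calc ∑ n ∈ Finset.Icc (k - m) (k - 1), |a n| * |a (k - n)|
        = ∑ n ∈ Finset.Icc (k - m) (k - 1), |a (k - (k - n))| * |a (k - n)| := by
          refine Finset.sum_congr rfl (fun n hn => ?_)
          rw [Finset.mem_Icc] at hn
          rw [Nat.sub_sub_self (by omega : n ≤ k)]
      _ = ∑ j ∈ (Finset.Icc (k - m) (k - 1)).image (fun n : ℕ => k - n), |a (k - j)| * |a j| :=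
          (Finset.sum_image (f := fun j : ℕ => |a (k - j)| * |a j|) hinj).symm
      _ = ∑ j ∈ Finset.Icc 1 m, |a j| * |a (k - j)| := by
          rw [himg]
          exact Finset.sum_congr rfl (fun j _ => mul_comm _ _)
      _ ≤ _ := hA
  have e1 : ((k - m - m - 1 : ℕ) : ℝ) = ((k - 2 * m - 1 : ℕ) : ℝ) := by
    congr 1
    omega
  rw [e1] at hB
  calc _ ≤ (q ^ k)⁻¹ * S * ∑ n ∈ Finset.Icc 1 m, q ^ n * α n +
        (q ^ k)⁻¹ * S ^ 2 * ((k - 2 * m - 1 : ℕ) : ℝ) +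
        (q ^ k)⁻¹ * S * ∑ n ∈ Finset.Icc 1 m, q ^ n * α n := add_le_add (add_le_add hA hB) hC
    _ = _ := by ring

/-- **[WZ 2020, Lemma 21 with Lemma 19]** (the shifted sum `Σ_n a_n a_{n+k}` at a mode `k > m`):
if `|a_n| ≤ ã_n` for `1 ≤ n ≤ m` and `|a_n| ≤ S q^{-n}` for `n > m`, then for every finite set
`J` of indices `n ≥ 1`,
`∑_{n∈J} |a_n| |a_{n+k}| ≤ q^{-k} S (∑_{n=1}^{m} q^{-n} ã_n + S q^{-2m}/(q²-1))`.
[cite: WilczakZgliczynski2020, §5.2 Lemmas 19 and 21] -/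
theorem sum_abs_mul_add_le_of_gbound {q S : ℝ} (hq : 1 < q) (hS0 : 0 ≤ S) {m : ℕ}
    {a α : ℕ → ℝ} (hα : ∀ n : ℕ, 1 ≤ n → n ≤ m → |a n| ≤ α n)
    (hS : ∀ n : ℕ, m < n → |a n| ≤ S / q ^ n) {k : ℕ} (hk : m < k) (J : Finset ℕ)
    (hJ : ∀ n ∈ J, 1 ≤ n) :
    ∑ n ∈ J, |a n| * |a (n + k)| ≤ (q ^ k)⁻¹ * S *
      (∑ n ∈ Finset.Icc 1 m, (q ^ n)⁻¹ * α n + S * ((q ^ (2 * m))⁻¹ / (q ^ 2 - 1))) := by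
  classical
  rw [← Finset.sum_filter_add_sum_filter_not J (fun n => n ≤ m)]
  have h1 : ∑ n ∈ J.filter (fun n => n ≤ m), |a n| * |a (n + k)| ≤
      (q ^ k)⁻¹ * S * ∑ n ∈ Finset.Icc 1 m, (q ^ n)⁻¹ * α n := by
    refine le_trans (Finset.sum_le_sum_of_subset_of_nonneg (fun n hn => ?_)
      (fun n _ _ => by positivity)) (sum_Icc_abs_mul_add_le hq hα hS hk)
    rw [Finset.mem_filter] at hn
    rw [Finset.mem_Icc]
    exact ⟨hJ n hn.1, hn.2⟩
  have h2 : ∑ n ∈ J.filter (fun n => ¬ n ≤ m), |a n| * |a (n + k)| ≤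
      S ^ 2 * (q ^ k)⁻¹ * ((q ^ (2 * m))⁻¹ / (q ^ 2 - 1)) :=
    sum_abs_mul_add_le_of_tail hq hS0 hS k _ (fun n hn => by
      rw [Finset.mem_filter, not_le] at hn
      exact hn.2)
  calc _ ≤ _ := add_le_add h1 h2
    _ = _ := by ring

/-! ### The KS nonlinearity at a far mode -/

/-- **KS nonlinearity on `GBound(m, ã, S, q)` at a far mode** ([WZ 2020, Lemmas 19 and 21] with
their constants kept separate): for `k > 2m` and every finite `J ⊆ [1, ∞)`,
`k ∑_{n=1}^{k-1} |a_n||a_{k-n}| + 2k ∑_{n∈J} |a_n||a_{n+k}| ≤ q^{-k} k (c₁ + S² (k - 2m - 1))` with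
`c₁ = 2S (∑_{n=1}^{m} q^n ã_n + ∑_{n=1}^{m} q^{-n} ã_n + S q^{-2m}/(q²-1))`.
[cite: WilczakZgliczynski2020, §5.2 Lemmas 19 and 21] -/
theorem ks_quadratic_le_of_gbound {q S : ℝ} (hq : 1 < q) (hS0 : 0 ≤ S) {m : ℕ} {a α : ℕ → ℝ}
    (hα : ∀ n : ℕ, 1 ≤ n → n ≤ m → |a n| ≤ α n) (hS : ∀ n : ℕ, m < n → |a n| ≤ S / q ^ n)
    {k : ℕ} (hk : 2 * m < k) (J : Finset ℕ) (hJ : ∀ n ∈ J, 1 ≤ n) :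
    (k : ℝ) * ∑ n ∈ Finset.Ioo 0 k, |a n| * |a (k - n)| +
        2 * (k : ℝ) * ∑ n ∈ J, |a n| * |a (n + k)| ≤
      (q ^ k)⁻¹ * k * (2 * S * (∑ n ∈ Finset.Icc 1 m, q ^ n * α n +
        ∑ n ∈ Finset.Icc 1 m, (q ^ n)⁻¹ * α n + S * ((q ^ (2 * m))⁻¹ / (q ^ 2 - 1))) +
        S ^ 2 * ((k - 2 * m - 1 : ℕ) : ℝ)) := by
  have hA := sum_Ioo_abs_mul_sub_le_of_gbound hq hS0 hα hS hk
  have hB := sum_abs_mul_add_le_of_gbound hq hS0 hα hS (by omega : m < k) J hJ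
  have hk0 : (0 : ℝ) ≤ k := Nat.cast_nonneg k
  calc (k : ℝ) * ∑ n ∈ Finset.Ioo 0 k, |a n| * |a (k - n)| +
        2 * (k : ℝ) * ∑ n ∈ J, |a n| * |a (n + k)|
      ≤ (k : ℝ) * ((q ^ k)⁻¹ * (2 * S * ∑ n ∈ Finset.Icc 1 m, q ^ n * α n +
          S ^ 2 * ((k - 2 * m - 1 : ℕ) : ℝ))) +
        2 * (k : ℝ) * ((q ^ k)⁻¹ * S * (∑ n ∈ Finset.Icc 1 m, (q ^ n)⁻¹ * α n +
          S * ((q ^ (2 * m))⁻¹ / (q ^ 2 - 1)))) :=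
        add_le_add (mul_le_mul_of_nonneg_left hA hk0) (mul_le_mul_of_nonneg_left hB (by positivity))
    _ = _ := by ring

/-- The same for the signed nonlinearity of any Galerkin truncation:
`|-k ∑_{n=1}^{k-1} a_n a_{k-n} + 2k ∑_{n∈J} a_n a_{n+k}| ≤ q^{-k} k (c₁ + S² (k - 2m - 1))`
(`k > 2m`, `J ⊆ [1, ∞)` finite). [cite: WilczakZgliczynski2020, §5.2 Lemmas 19 and 21] -/
theorem ks_nonlinearity_abs_le_of_gbound {q S : ℝ} (hq : 1 < q) (hS0 : 0 ≤ S) {m : ℕ}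
    {a α : ℕ → ℝ} (hα : ∀ n : ℕ, 1 ≤ n → n ≤ m → |a n| ≤ α n)
    (hS : ∀ n : ℕ, m < n → |a n| ≤ S / q ^ n) {k : ℕ} (hk : 2 * m < k) (J : Finset ℕ)
    (hJ : ∀ n ∈ J, 1 ≤ n) :
    |-(k : ℝ) * ∑ n ∈ Finset.Ioo 0 k, a n * a (k - n) + 2 * (k : ℝ) * ∑ n ∈ J, a n * a (n + k)| ≤
      (q ^ k)⁻¹ * k * (2 * S * (∑ n ∈ Finset.Icc 1 m, q ^ n * α n +
        ∑ n ∈ Finset.Icc 1 m, (q ^ n)⁻¹ * α n + S * ((q ^ (2 * m))⁻¹ / (q ^ 2 - 1))) +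
        S ^ 2 * ((k - 2 * m - 1 : ℕ) : ℝ)) := by
  refine le_trans ?_ (ks_quadratic_le_of_gbound hq hS0 hα hS hk J hJ)
  have hk0 : (0 : ℝ) ≤ k := Nat.cast_nonneg k
  have h1 : |-(k : ℝ) * ∑ n ∈ Finset.Ioo 0 k, a n * a (k - n)| ≤
      (k : ℝ) * ∑ n ∈ Finset.Ioo 0 k, |a n| * |a (k - n)| := by
    rw [abs_mul, abs_neg, abs_of_nonneg hk0]
    refine mul_le_mul_of_nonneg_left ((Finset.abs_sum_le_sum_abs _ _).trans (le_of_eq ?_)) hk0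
    exact Finset.sum_congr rfl (fun n _ => abs_mul _ _)
  have h2 : |2 * (k : ℝ) * ∑ n ∈ J, a n * a (n + k)| ≤
      2 * (k : ℝ) * ∑ n ∈ J, |a n| * |a (n + k)| := by
    rw [abs_mul, abs_of_nonneg (by positivity : (0 : ℝ) ≤ 2 * k)]
    refine mul_le_mul_of_nonneg_left ((Finset.abs_sum_le_sum_abs _ _).trans (le_of_eq ?_))
      (by positivity)
    exact Finset.sum_congr rfl (fun n _ => abs_mul _ _)
  exact (abs_add_le _ _).trans (add_le_add h1 h2)

/-- **Condition C2 for KS on `W_{q,S}`** ([WZ 2020, §5.1]): if `|a_n| ≤ S q^{-n}` for all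
`n ≥ 1`, then for every `k` and every finite `J ⊆ [1, ∞)`,
`k ∑_{n=1}^{k-1} |a_n||a_{k-n}| + 2k ∑_{n∈J} |a_n||a_{n+k}| ≤ k(k-1)S²q^{-k} + 2kS²q^{-k}/(q²-1)`
(all `k`).
[cite: WilczakZgliczynski2020, §5.1 (C2 for the KS equation)] -/
theorem ks_quadratic_le_of_geom {q S : ℝ} (hq : 1 < q) (hS0 : 0 ≤ S) {a : ℕ → ℝ}
    (hS : ∀ n : ℕ, 0 < n → |a n| ≤ S / q ^ n) (k : ℕ) (J : Finset ℕ) (hJ : ∀ n ∈ J, 1 ≤ n) :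
    (k : ℝ) * ∑ n ∈ Finset.Ioo 0 k, |a n| * |a (k - n)| +
        2 * (k : ℝ) * ∑ n ∈ J, |a n| * |a (n + k)| ≤
      (k : ℝ) * ((k - 1 : ℕ) : ℝ) * S ^ 2 * (q ^ k)⁻¹ +
        2 * (k : ℝ) * S ^ 2 * (q ^ k)⁻¹ / (q ^ 2 - 1) := by
  have hA := sum_Ioo_abs_mul_sub_le hq hS0 hS k (m := 0)
  have hB := sum_abs_mul_add_le_of_tail hq hS0 hS k J (fun n hn => hJ n hn) (m := 0)
  simp only [Nat.sub_zero, mul_zero, pow_zero, inv_one, one_div] at hA hB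
  have hk0 : (0 : ℝ) ≤ k := Nat.cast_nonneg k
  calc _ ≤ (k : ℝ) * ((q ^ k)⁻¹ * S ^ 2 * ((k - 1 : ℕ) : ℝ)) +
        2 * (k : ℝ) * (S ^ 2 * (q ^ k)⁻¹ * (q ^ 2 - 1)⁻¹) :=
        add_le_add (mul_le_mul_of_nonneg_left hA hk0) (mul_le_mul_of_nonneg_left hB (by positivity))
    _ = _ := by ring

/-- **Condition C2 for KS on `W_{q,S}`, the printed constant**: under the same hypotheses,
`|-k ∑_{n=1}^{k-1} a_n a_{k-n} + 2k ∑_{n∈J} a_n a_{n+k}| ≤ 2k² q^{-k} S² (1 + 1/(q²-1))`, i.e.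
`|N_k(a)| ≤ D k^r q^{-k}` with `r = 2`, `D = 2S²(1 + (q²-1)^{-1})`.
[cite: WilczakZgliczynski2020, §5.1 (C2 for the KS equation: r = 2, D = 2S²(1+(q²-1)⁻¹))] -/
theorem ks_nonlinearity_abs_le_of_geom {q S : ℝ} (hq : 1 < q) (hS0 : 0 ≤ S) {a : ℕ → ℝ}
    (hS : ∀ n : ℕ, 0 < n → |a n| ≤ S / q ^ n) (k : ℕ) (J : Finset ℕ) (hJ : ∀ n ∈ J, 1 ≤ n) :
    |-(k : ℝ) * ∑ n ∈ Finset.Ioo 0 k, a n * a (k - n) + 2 * (k : ℝ) * ∑ n ∈ J, a n * a (n + k)| ≤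
      2 * (k : ℝ) ^ 2 * (q ^ k)⁻¹ * S ^ 2 * (1 + (q ^ 2 - 1)⁻¹) := by
  have hq2 : 0 < q ^ 2 - 1 := by nlinarith
  have hk0 : (0 : ℝ) ≤ k := Nat.cast_nonneg k
  have h1 : |-(k : ℝ) * ∑ n ∈ Finset.Ioo 0 k, a n * a (k - n)| ≤
      (k : ℝ) * ∑ n ∈ Finset.Ioo 0 k, |a n| * |a (k - n)| := by
    rw [abs_mul, abs_neg, abs_of_nonneg hk0]
    refine mul_le_mul_of_nonneg_left ((Finset.abs_sum_le_sum_abs _ _).trans (le_of_eq ?_)) hk0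
    exact Finset.sum_congr rfl (fun n _ => abs_mul _ _)
  have h2 : |2 * (k : ℝ) * ∑ n ∈ J, a n * a (n + k)| ≤
      2 * (k : ℝ) * ∑ n ∈ J, |a n| * |a (n + k)| := by
    rw [abs_mul, abs_of_nonneg (by positivity : (0 : ℝ) ≤ 2 * k)]
    refine mul_le_mul_of_nonneg_left ((Finset.abs_sum_le_sum_abs _ _).trans (le_of_eq ?_))
      (by positivity)
    exact Finset.sum_congr rfl (fun n _ => abs_mul _ _)
  have h3 := ks_quadratic_le_of_geom hq hS0 hS k J hJ
  have hk1 : ((k - 1 : ℕ) : ℝ) ≤ k := by exact_mod_cast Nat.sub_le k 1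
  -- `k(k-1) ≤ 2k²` and `2k ≤ 2k²` for a natural number `k`
  have hkk : (k : ℝ) ≤ (k : ℝ) ^ 2 := by
    rcases Nat.eq_zero_or_pos k with h | h
    · simp [h]
    · have : (1 : ℝ) ≤ k := by exact_mod_cast h
      nlinarith
  have hX : 0 ≤ S ^ 2 * (q ^ k)⁻¹ := by
    have : 0 < q ^ k := pow_pos (by linarith) k
    positivity
  have h4 : (k : ℝ) * ((k - 1 : ℕ) : ℝ) * S ^ 2 * (q ^ k)⁻¹ +
      2 * (k : ℝ) * S ^ 2 * (q ^ k)⁻¹ / (q ^ 2 - 1) ≤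
      2 * (k : ℝ) ^ 2 * (q ^ k)⁻¹ * S ^ 2 * (1 + (q ^ 2 - 1)⁻¹) := by
    have e : 2 * (k : ℝ) ^ 2 * (q ^ k)⁻¹ * S ^ 2 * (1 + (q ^ 2 - 1)⁻¹) =
        2 * (k : ℝ) ^ 2 * (S ^ 2 * (q ^ k)⁻¹) +
          2 * (k : ℝ) ^ 2 * (S ^ 2 * (q ^ k)⁻¹) / (q ^ 2 - 1) := by
      field_simp
    rw [e]
    refine add_le_add ?_ ?_
    · have : (k : ℝ) * ((k - 1 : ℕ) : ℝ) ≤ 2 * (k : ℝ) ^ 2 := by nlinarith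
      calc (k : ℝ) * ((k - 1 : ℕ) : ℝ) * S ^ 2 * (q ^ k)⁻¹
          = (k : ℝ) * ((k - 1 : ℕ) : ℝ) * (S ^ 2 * (q ^ k)⁻¹) := by ring
        _ ≤ 2 * (k : ℝ) ^ 2 * (S ^ 2 * (q ^ k)⁻¹) := mul_le_mul_of_nonneg_right this hX
    · refine div_le_div_of_nonneg_right ?_ hq2.le
      calc 2 * (k : ℝ) * S ^ 2 * (q ^ k)⁻¹ = 2 * (k : ℝ) * (S ^ 2 * (q ^ k)⁻¹) := by ring
        _ ≤ 2 * (k : ℝ) ^ 2 * (S ^ 2 * (q ^ k)⁻¹) := by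
            refine mul_le_mul_of_nonneg_right ?_ hX
            linarith
  exact (abs_add_le _ _).trans ((add_le_add h1 h2).trans (h3.trans h4))

/-! ### The uniform far-tail bound: monotonicity in the mode number -/

/-- The KS linear part at a far mode is dissipative: if `ν K² > 1` and `k ≥ K`, then
`ν k⁴ - k² = k²(νk² - 1) > 0`. [cite: WilczakZgliczynski2020, §5.1 (C1 for KS: L_k = k²(νk²-1))] -/
theorem ks_eigen_pos {ν : ℝ} (hν : 0 < ν) {K k : ℕ} (hK : 1 < ν * (K : ℝ) ^ 2) (hk : K ≤ k) :
    0 < ν * (k : ℝ) ^ 4 - (k : ℝ) ^ 2 := by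
  have hKk : (K : ℝ) ≤ k := by exact_mod_cast hk
  have hK0 : (0 : ℝ) ≤ K := Nat.cast_nonneg K
  have hKk2 : ν * (K : ℝ) ^ 2 ≤ ν * (k : ℝ) ^ 2 :=
    mul_le_mul_of_nonneg_left (pow_le_pow_left₀ hK0 hKk 2) hν.le
  have hk2 : 1 < ν * (k : ℝ) ^ 2 := lt_of_lt_of_le hK hKk2
  have hkpos : (0 : ℝ) < k := by
    rcases Nat.eq_zero_or_pos k with h | h
    · subst h; simp at hk2; linarith
    · exact_mod_cast h
  have e : ν * (k : ℝ) ^ 4 - (k : ℝ) ^ 2 = (k : ℝ) ^ 2 * (ν * (k : ℝ) ^ 2 - 1) := by ring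
  rw [e]
  exact mul_pos (by positivity) (by linarith)

/-- `|λ_k| = ν k⁴ - k²` is strictly increasing on the far modes: if `ν K² > 1` and `K ≤ k < k'`,
then `ν k⁴ - k² < ν k'⁴ - k'²` (the difference is `(k'² - k²)(ν(k'² + k²) - 1)`).
[cite: WilczakZgliczynski2020, §5.1 (C1 for KS: L_k = k²(νk²-1))] -/
theorem ks_eigen_lt {ν : ℝ} (hν : 0 < ν) {K k k' : ℕ} (hK : 1 < ν * (K : ℝ) ^ 2) (hk : K ≤ k)
    (hkk' : k < k') : ν * (k : ℝ) ^ 4 - (k : ℝ) ^ 2 < ν * (k' : ℝ) ^ 4 - (k' : ℝ) ^ 2 := by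
  have hKk : (K : ℝ) ≤ k := by exact_mod_cast hk
  have hK0 : (0 : ℝ) ≤ K := Nat.cast_nonneg K
  have hk0 : (0 : ℝ) ≤ k := Nat.cast_nonneg k
  have hlt : (k : ℝ) < k' := by exact_mod_cast hkk'
  have hKk2 : ν * (K : ℝ) ^ 2 ≤ ν * (k : ℝ) ^ 2 :=
    mul_le_mul_of_nonneg_left (pow_le_pow_left₀ hK0 hKk 2) hν.le
  have hk2 : 1 < ν * (k : ℝ) ^ 2 := lt_of_lt_of_le hK hKk2
  have e : ν * (k' : ℝ) ^ 4 - (k' : ℝ) ^ 2 - (ν * (k : ℝ) ^ 4 - (k : ℝ) ^ 2) =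
      ((k' : ℝ) ^ 2 - (k : ℝ) ^ 2) * (ν * ((k' : ℝ) ^ 2 + (k : ℝ) ^ 2) - 1) := by ring
  have h1 : 0 < (k' : ℝ) ^ 2 - (k : ℝ) ^ 2 := by nlinarith
  have h2 : 0 < ν * ((k' : ℝ) ^ 2 + (k : ℝ) ^ 2) - 1 := by nlinarith
  have := mul_pos h1 h2
  linarith

/-- The far-tail ratio is non-increasing in the mode number: for `c₁, c₂ ≥ 0`, `ν K² > 1` and
`k ≥ K`, `(c₁/k + c₂)/(νk² - 1) ≤ (c₁/K + c₂)/(νK² - 1)`.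
[cite: WilczakZgliczynski2020, §4.3 (proof of Lemma 18: D/(L_* k^{s-r}) ≤ D/(L_* (m+1)^{s-r}))] -/
theorem far_ratio_le {ν c₁ c₂ : ℝ} (hν : 0 < ν) (hc₁ : 0 ≤ c₁) (hc₂ : 0 ≤ c₂) {K k : ℕ}
    (hK : 1 < ν * (K : ℝ) ^ 2) (hk : K ≤ k) :
    (c₁ / k + c₂) / (ν * (k : ℝ) ^ 2 - 1) ≤ (c₁ / K + c₂) / (ν * (K : ℝ) ^ 2 - 1) := by
  have hKk : (K : ℝ) ≤ k := by exact_mod_cast hk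
  have hK0 : (0 : ℝ) ≤ K := Nat.cast_nonneg K
  have hKpos : (0 : ℝ) < K := by
    rcases Nat.eq_zero_or_pos K with h | h
    · subst h; simp at hK; linarith
    · exact_mod_cast h
  have hKk2 : ν * (K : ℝ) ^ 2 ≤ ν * (k : ℝ) ^ 2 :=
    mul_le_mul_of_nonneg_left (pow_le_pow_left₀ hK0 hKk 2) hν.le
  have hk2 : ν * (K : ℝ) ^ 2 - 1 ≤ ν * (k : ℝ) ^ 2 - 1 := by linarith
  refine div_le_div₀ (by positivity) ?_ (by linarith) hk2
  exact add_le_add (div_le_div_of_nonneg_left hc₁ hKpos hKk) le_rfl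

/-- **The uniform far-tail bound** (engine form): if a quantity `x` (e.g. `|F_k - λ_k a_k|`) is at
most `q^{-k} k (c₁ + c₂ k)` at a mode `k ≥ K` with `ν K² > 1`, then its `q`-weighted ratio to the
linear part satisfies `q^k x/(νk⁴ - k²) ≤ (c₁/K + c₂)/(νK² - 1)`, uniformly in `k ≥ K`.
[cite: WilczakZgliczynski2020, §4.3 (proof of Lemma 18: uniform tail estimate for k > m)] -/
theorem far_weighted_le {ν c₁ c₂ q x : ℝ} (hν : 0 < ν) (hc₁ : 0 ≤ c₁) (hc₂ : 0 ≤ c₂)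
    (hq : 0 < q) {K k : ℕ} (hK : 1 < ν * (K : ℝ) ^ 2) (hk : K ≤ k)
    (hx : x ≤ (q ^ k)⁻¹ * k * (c₁ + c₂ * k)) :
    q ^ k * x / (ν * (k : ℝ) ^ 4 - (k : ℝ) ^ 2) ≤ (c₁ / K + c₂) / (ν * (K : ℝ) ^ 2 - 1) := by
  have hL := ks_eigen_pos hν hK hk
  have hKk : (K : ℝ) ≤ k := by exact_mod_cast hk
  have hK0 : (0 : ℝ) ≤ K := Nat.cast_nonneg K
  have hKk2 : ν * (K : ℝ) ^ 2 ≤ ν * (k : ℝ) ^ 2 :=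
    mul_le_mul_of_nonneg_left (pow_le_pow_left₀ hK0 hKk 2) hν.le
  have hk2 : 1 < ν * (k : ℝ) ^ 2 := lt_of_lt_of_le hK hKk2
  have hkpos : (0 : ℝ) < k := by
    rcases Nat.eq_zero_or_pos k with h | h
    · subst h; simp at hk2; linarith
    · exact_mod_cast h
  have hqk : 0 < q ^ k := pow_pos hq k
  have h1 : q ^ k * x ≤ (k : ℝ) * (c₁ + c₂ * k) := by
    calc q ^ k * x ≤ q ^ k * ((q ^ k)⁻¹ * k * (c₁ + c₂ * k)) :=
          mul_le_mul_of_nonneg_left hx hqk.le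
      _ = (k : ℝ) * (c₁ + c₂ * k) := by field_simp
  have h2 : q ^ k * x / (ν * (k : ℝ) ^ 4 - (k : ℝ) ^ 2) ≤
      (k : ℝ) * (c₁ + c₂ * k) / (ν * (k : ℝ) ^ 4 - (k : ℝ) ^ 2) :=
    div_le_div_of_nonneg_right h1 hL.le
  have h3 : (k : ℝ) * (c₁ + c₂ * k) / (ν * (k : ℝ) ^ 4 - (k : ℝ) ^ 2) =
      (c₁ / k + c₂) / (ν * (k : ℝ) ^ 2 - 1) := by
    have hk2' : ν * (k : ℝ) ^ 2 - 1 ≠ 0 := by linarith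
    field_simp
  rw [h3] at h2
  exact h2.trans (far_ratio_le hν hc₁ hc₂ hK hk)

end Literature.Analysis.ODE
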